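import Summits.NavierStokesRegularity.OSWSelfSimilar.SheetRGainWeights
import Mathlib.Analysis.Calculus.ContDiff.Deriv
import Mathlib.MeasureTheory.Integral.IntegralEqImproper
import HarnessLib

/-!
# SHEET-ℝ: polynomial-weight GAIN for the 1-D similarity operator `νΨ″ − (½ξ + b)Ψ′ − (κ + c)Ψ = g` below the drift threshold

HONEST FRAMING (cell ns-blowup GROUP B / zone Z3, case Z3-SR-SPEC item (P6b); 1-D MODEL calculus; not Euler, not NS).
A generic weighted a priori estimate; nothing here asserts that any profile exists.

THE ESTIMATE. Let `ν > 0`, `k : ℕ`, and let `Ψ ∈ C²(ℝ)` solve, at every `ξ`,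
  `ν Ψ″ = (½ξ + b) Ψ′ + (κ + c) Ψ + g`,
with `b ∈ C¹` bounded (`|b| ≤ B₀`), `c`, `g` continuous, and the perturbations SMALL AT INFINITY relative to the gap
`δ := κ − (2k+3)/4 > 0`: `|b′|/2 + |c| ≤ δ/4` for `|ξ| ≥ R` (and `|b′| ≤ B₁`, `|c| ≤ C₀` everywhere). If `Ψ` lies in the
weighted class of order `k` — `∫(1+ξ²)^k (Ψ² + Ψ′²) < ∞` — and `∫(1+ξ²)^{k+1} g² < ∞`, then `Ψ` lies in the class of order
`k+1`: `∫(1+ξ²)^{k+1} (Ψ² + Ψ′²) < ∞` (`Summit.NavierStokesRegularity.OSWSelfSimilar.SheetRWeightedGain.weighted_gain`).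

WHY `(2k+3)/4`: testing the equation against `θΨ` with the regularised weight `θ = θ_ε` of `SheetRGainWeights`
(`θ ≈ (1+ξ²)^{k+1}`, `ξθ′ ≤ 2(k+1)θ`) and integrating by parts on the whole line, the drift `½ξ∂_ξ` contributes
`−¼∫(θ + ξθ′)Ψ² ≥ −((2k+3)/4)∫θΨ²`, so exactly the excess `δ` of `κ` over `(2k+3)/4` is coercive; this is the
polynomial-weight ↔ spectrum threshold of similarity-variable (Ornstein–Uhlenbeck-type) operators (cf. Gallay–Wayne,
Arch. Rational Mech. Anal. 163 (2002), Appendix A) and, for the sheet, the decay law `c_l·p = 1` of `SheetRDecayLaw`.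
The `ε → 0⁺` limit is Fatou's lemma. For the Z3-SR-SPEC item (P6b) («the T-shift mode `Ω* + ½ξΩ*′` lies in
`E = odd H¹_{64+ξ²}`») apply it twice to `Ψ = Ω*′` (`κ = 3/2`, `b = a𝒰Ω*`, `c = (a−1)HΩ*`, `g = −(HΩ*′)Ω*`;
thresholds `3/2 > 3/4` and `3/2 > 5/4`), which is bookkeeping on the MODEL side and is NOT done here.
[folklore] weighted energy estimate; MODEL-support calculus, no NS content.
-/

noncomputable section

namespace Summit.NavierStokesRegularity.OSWSelfSimilar
namespace SheetRWeightedGain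

open _root_.MeasureTheory _root_.Set _root_.Filter SheetRGainWeights
open scoped Topology ENNReal

/-! ### §1 The estimate at fixed `ε` (weights and pointwise algebra from `SheetRGainWeights`) -/

section fixedEps

variable {ν κ δ B₀ B₁ C₀ R : ℝ} {k : ℕ} {Ψ b c g : ℝ → ℝ}

/-- Bounded × integrable is integrable (continuous bounded multiplier). [folklore] -/
private lemma integrable_bdd_mul {φ h : ℝ → ℝ} (C : ℝ) (hφ : Continuous φ) (hC : ∀ x, |φ x| ≤ C)
    (hh : Integrable h) : Integrable fun x => φ x * h x :=
  hh.bdd_mul hφ.aestronglyMeasurable (Eventually.of_forall fun x => by rw [Real.norm_eq_abs]; exact hC x)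

/-- **The weighted energy inequality at fixed regularisation `0 < ε ≤ 1`.** With `θ = gw k ε` and
`M := (B₁/2 + C₀)(1+R²)^{k+1} + B₀²·Dsq k/(2δ) + ν·Dsq k/2`:
`(ν/2)∫θΨ′² + (3δ/8)∫θΨ² ≤ M·∫(1+ξ²)^kΨ² + (2/δ)·∫(1+ξ²)^{k+1}g²`. [folklore] -/
theorem weighted_bound_eps (hν : 0 < ν) (hδ0 : 0 < δ) (hκ : κ = δ + (2 * k + 3) / 4)
    (hΨ : ContDiff ℝ 2 Ψ) (hb : ContDiff ℝ 1 b) (hc : Continuous c) (hg : Continuous g)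
    (hEq : ∀ ξ, ν * deriv (deriv Ψ) ξ = (ξ / 2 + b ξ) * deriv Ψ ξ + (κ + c ξ) * Ψ ξ + g ξ)
    (hΨk : Integrable fun ξ => (1 + ξ ^ 2) ^ k * Ψ ξ ^ 2)
    (hΨ'k : Integrable fun ξ => (1 + ξ ^ 2) ^ k * deriv Ψ ξ ^ 2)
    (hgk : Integrable fun ξ => (1 + ξ ^ 2) ^ (k + 1) * g ξ ^ 2)
    (hB₀ : ∀ ξ, |b ξ| ≤ B₀) (hB₁ : ∀ ξ, |deriv b ξ| ≤ B₁) (hC₀ : ∀ ξ, |c ξ| ≤ C₀)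
    (htail : ∀ ξ, R ≤ |ξ| → |deriv b ξ| / 2 + |c ξ| ≤ δ / 4) {ε : ℝ} (hε : 0 < ε) (hε1 : ε ≤ 1) :
    ν / 2 * (∫ ξ, gw k ε ξ * deriv Ψ ξ ^ 2) + 3 * δ / 8 * (∫ ξ, gw k ε ξ * Ψ ξ ^ 2) ≤
      ((B₁ / 2 + C₀) * (1 + R ^ 2) ^ (k + 1) + B₀ ^ 2 * Dsq k / (2 * δ) + ν * Dsq k / 2)
          * (∫ ξ, (1 + ξ ^ 2) ^ k * Ψ ξ ^ 2)
        + 2 / δ * (∫ ξ, (1 + ξ ^ 2) ^ (k + 1) * g ξ ^ 2) := by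
  have hε0 := hε.le
  -- names
  set θ : ℝ → ℝ := gw k ε with hθdef
  set ℓ : ℝ → ℝ := gwl k ε with hℓdef
  set Ψ' : ℝ → ℝ := deriv Ψ with hΨ'def
  set Ψ'' : ℝ → ℝ := deriv (deriv Ψ) with hΨ''def
  set b' : ℝ → ℝ := deriv b with hb'def
  set M₁ : ℝ := (B₁ / 2 + C₀) * (1 + R ^ 2) ^ (k + 1) with hM₁def
  -- weight facts
  have hθpos : ∀ ξ, 0 < θ ξ := fun ξ => gw_pos hε0
  have hθ' : ∀ ξ, HasDerivAt θ (θ ξ * ℓ ξ) ξ := fun ξ => hasDerivAt_gw hε0 ξ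
  have hθc : Continuous θ := continuous_gw hε0
  have hℓc : Continuous ℓ := continuous_gwl hε0
  have hθbd : ∀ ξ, |θ ξ| ≤ (1 / ε) ^ (k + 1) := fun ξ => by
    rw [abs_of_pos (hθpos ξ)]; exact gw_le_inv_pow hε hε1
  have hξθbd : ∀ ξ, |ξ * θ ξ| ≤ (1 / ε) ^ (k + 1) + (1 / ε) ^ (k + 2) := fun ξ => by
    rw [abs_mul, abs_of_pos (hθpos ξ)]; exact abs_mul_gw_le hε hε1
  have hℓbd : ∀ ξ, |ℓ ξ| ≤ 1 + Dsq k := fun ξ => abs_gwl_le hε0 hε1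
  have hξℓbd : ∀ ξ, |ξ * ℓ ξ| ≤ 1 + Dsq k := fun ξ => abs_id_mul_gwl_le hε0 hε1
  -- `C²` / `C¹` facts
  have hΨ'cd : ContDiff ℝ 1 Ψ' := (contDiff_succ_iff_deriv.1 (hΨ : ContDiff ℝ (1 + 1) Ψ)).2.2
  have hd1 : ∀ x, HasDerivAt Ψ (Ψ' x) x := fun x => ((hΨ.differentiable (by norm_num)) x).hasDerivAt
  have hd2 : ∀ x, HasDerivAt Ψ' (Ψ'' x) x := fun x => ((hΨ'cd.differentiable (by norm_num)) x).hasDerivAt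
  have hdb : ∀ x, HasDerivAt b (b' x) x := fun x => ((hb.differentiable (by norm_num)) x).hasDerivAt
  have hΨc : Continuous Ψ := hΨ.continuous
  have hΨ'c : Continuous Ψ' := hΨ'cd.continuous
  have hΨ''c : Continuous Ψ'' := hΨ'cd.continuous_deriv le_rfl
  have hbc' : Continuous b := hb.continuous
  have hb'c : Continuous b' := hb.continuous_deriv le_rfl
  -- base integrability (`(1+ξ²)^k ≥ 1`)
  have hP0 : ∀ ξ : ℝ, 1 ≤ (1 + ξ ^ 2) ^ k := fun ξ => one_le_pow₀ (by nlinarith [sq_nonneg ξ])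
  have iΨ2 : Integrable fun ξ => Ψ ξ ^ 2 := by
    refine hΨk.mono' (by fun_prop) (Eventually.of_forall fun ξ => ?_)
    rw [Real.norm_eq_abs, abs_of_nonneg (sq_nonneg _)]
    nlinarith [hP0 ξ, sq_nonneg (Ψ ξ)]
  have iΨ'2 : Integrable fun ξ => Ψ' ξ ^ 2 := by
    refine hΨ'k.mono' (by fun_prop) (Eventually.of_forall fun ξ => ?_)
    rw [Real.norm_eq_abs, abs_of_nonneg (sq_nonneg _)]
    nlinarith [hP0 ξ, sq_nonneg (Ψ' ξ)]
  have iΨΨ' : Integrable fun ξ => Ψ ξ * Ψ' ξ := by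
    refine ((iΨ2.add iΨ'2).div_const 2).mono' (by fun_prop) (Eventually.of_forall fun ξ => ?_)
    rw [Real.norm_eq_abs, abs_mul]
    have := two_mul_le_add_sq (|Ψ ξ|) (|Ψ' ξ|)
    simp only [sq_abs, Pi.add_apply] at this ⊢
    linarith
  -- weighted integrability
  have hDsq : 0 ≤ Dsq k := Dsq_nonneg
  have hB₀nn : 0 ≤ B₀ := (abs_nonneg _).trans (hB₀ 0)
  have I1 : Integrable fun ξ => θ ξ * Ψ' ξ ^ 2 := integrable_bdd_mul _ hθc hθbd iΨ'2
  have I2 : Integrable fun ξ => θ ξ * Ψ ξ ^ 2 := integrable_bdd_mul _ hθc hθbd iΨ2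
  have I3 : Integrable fun ξ => θ ξ * ℓ ξ * (Ψ ξ * Ψ' ξ) := by
    refine integrable_bdd_mul ((1 / ε) ^ (k + 1) * (1 + Dsq k)) (hθc.mul hℓc) (fun x => ?_) iΨΨ'
    rw [abs_mul]; exact mul_le_mul (hθbd x) (hℓbd x) (abs_nonneg _) (by positivity)
  have I4 : Integrable fun ξ => ξ * θ ξ * (Ψ ξ * Ψ' ξ) :=
    integrable_bdd_mul (φ := fun ξ => ξ * θ ξ) _ (continuous_id.mul hθc) hξθbd iΨΨ'
  have I5 : Integrable fun ξ => b ξ * θ ξ * (Ψ ξ * Ψ' ξ) := by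
    refine integrable_bdd_mul (φ := fun ξ => b ξ * θ ξ) (B₀ * (1 / ε) ^ (k + 1)) (hbc'.mul hθc)
      (fun x => ?_) iΨΨ'
    rw [abs_mul]; exact mul_le_mul (hB₀ x) (hθbd x) (abs_nonneg _) hB₀nn
  have I6 : Integrable fun ξ => c ξ * θ ξ * Ψ ξ ^ 2 := by
    refine integrable_bdd_mul (φ := fun ξ => c ξ * θ ξ) (C₀ * (1 / ε) ^ (k + 1)) (hc.mul hθc)
      (fun x => ?_) iΨ2
    rw [abs_mul]; exact mul_le_mul (hC₀ x) (hθbd x) (abs_nonneg _) ((abs_nonneg _).trans (hC₀ x))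
  have I7 : Integrable fun ξ => b' ξ * θ ξ * Ψ ξ ^ 2 := by
    refine integrable_bdd_mul (φ := fun ξ => b' ξ * θ ξ) (B₁ * (1 / ε) ^ (k + 1)) (hb'c.mul hθc)
      (fun x => ?_) iΨ2
    rw [abs_mul]; exact mul_le_mul (hB₁ x) (hθbd x) (abs_nonneg _) ((abs_nonneg _).trans (hB₁ x))
  have I8 : Integrable fun ξ => ξ * ℓ ξ * θ ξ * Ψ ξ ^ 2 := by
    refine integrable_bdd_mul (φ := fun ξ => ξ * ℓ ξ * θ ξ) ((1 + Dsq k) * (1 / ε) ^ (k + 1))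
      ((continuous_id.mul hℓc).mul hθc) (fun x => ?_) iΨ2
    rw [abs_mul]; exact mul_le_mul (hξℓbd x) (hθbd x) (abs_nonneg _) (by positivity)
  have I9 : Integrable fun ξ => b ξ * ℓ ξ * θ ξ * Ψ ξ ^ 2 := by
    refine integrable_bdd_mul (φ := fun ξ => b ξ * ℓ ξ * θ ξ) (B₀ * (1 + Dsq k) * (1 / ε) ^ (k + 1))
      ((hbc'.mul hℓc).mul hθc) (fun x => ?_) iΨ2
    rw [abs_mul, abs_mul]
    exact mul_le_mul (mul_le_mul (hB₀ x) (hℓbd x) (abs_nonneg _) hB₀nn) (hθbd x) (abs_nonneg _)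
      (by positivity)
  have I10 : Integrable fun ξ => g ξ * θ ξ * Ψ ξ := by
    have hdom : Integrable fun ξ => ((1 + ξ ^ 2) ^ (k + 1) * g ξ ^ 2 + (1 / ε) ^ (k + 1) * Ψ ξ ^ 2) / 2 :=
      (hgk.add (iΨ2.const_mul _)).div_const 2
    refine hdom.mono' (by fun_prop) (Eventually.of_forall fun ξ => ?_)
    rw [Real.norm_eq_abs]
    have h1 : |g ξ * θ ξ * Ψ ξ| = θ ξ * (|g ξ| * |Ψ ξ|) := by
      rw [abs_mul, abs_mul, abs_of_pos (hθpos ξ)]; ring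
    have h2 : 2 * (|g ξ| * |Ψ ξ|) ≤ g ξ ^ 2 + Ψ ξ ^ 2 := by
      have := two_mul_le_add_sq (|g ξ|) (|Ψ ξ|); simp only [sq_abs] at this; linarith
    have h3 : θ ξ ≤ (1 + ξ ^ 2) ^ (k + 1) := gw_le_pow hε0
    have h4 : θ ξ ≤ (1 / ε) ^ (k + 1) := gw_le_inv_pow hε hε1
    rw [h1]
    nlinarith [hθpos ξ, mul_nonneg (abs_nonneg (g ξ)) (abs_nonneg (Ψ ξ)), sq_nonneg (g ξ),
      sq_nonneg (Ψ ξ), mul_le_mul_of_nonneg_right h3 (sq_nonneg (g ξ)),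
      mul_le_mul_of_nonneg_right h4 (sq_nonneg (Ψ ξ))]
  have I11 : Integrable fun ξ => θ ξ * Ψ ξ * Ψ'' ξ := by
    have hsum0 : Integrable fun ξ => 1 / 2 * (ξ * θ ξ * (Ψ ξ * Ψ' ξ)) + b ξ * θ ξ * (Ψ ξ * Ψ' ξ)
        + κ * (θ ξ * Ψ ξ ^ 2) + c ξ * θ ξ * Ψ ξ ^ 2 + g ξ * θ ξ * Ψ ξ :=
      ((((I4.const_mul _).add I5).add (I2.const_mul _)).add I6).add I10
    have hsum1 : Integrable fun ξ => 1 / ν * (θ ξ * Ψ ξ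
        * ((ξ / 2 + b ξ) * Ψ' ξ + (κ + c ξ) * Ψ ξ + g ξ)) := by
      refine (hsum0.const_mul (1 / ν)).congr (Eventually.of_forall fun ξ => ?_)
      ring
    refine hsum1.congr (Eventually.of_forall fun ξ => ?_)
    show 1 / ν * (θ ξ * Ψ ξ * ((ξ / 2 + b ξ) * Ψ' ξ + (κ + c ξ) * Ψ ξ + g ξ)) = θ ξ * Ψ ξ * Ψ'' ξ
    rw [← hEq ξ]
    field_simp
  -- the two exact derivatives `F₁ = θΨΨ′`, `F₂ = (ξ/2 + b)θΨ²` integrate to zero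
  have hF₁ : ∀ x, HasDerivAt (fun y => θ y * (Ψ y * Ψ' y))
      (θ x * ℓ x * Ψ x * Ψ' x + θ x * Ψ' x ^ 2 + θ x * Ψ x * Ψ'' x) x := fun x => by
    have h := (hθ' x).mul ((hd1 x).mul (hd2 x))
    have hfun : (θ * (Ψ * Ψ')) = fun y => θ y * (Ψ y * Ψ' y) := by
      funext y; simp only [Pi.mul_apply]
    rw [hfun] at h
    exact h.congr_deriv (by simp only [Pi.mul_apply]; ring)
  have hF₁int : Integrable fun y => θ y * (Ψ y * Ψ' y) := integrable_bdd_mul _ hθc hθbd iΨΨ'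
  have hF₁'int : Integrable fun x => θ x * ℓ x * Ψ x * Ψ' x + θ x * Ψ' x ^ 2 + θ x * Ψ x * Ψ'' x := by
    refine ((I3.add I1).add I11).congr (Eventually.of_forall fun x => ?_)
    simp only [Pi.add_apply]; ring
  have hZ₁ := integral_eq_zero_of_hasDerivAt_of_integrable hF₁ hF₁'int hF₁int
  have hF₂ : ∀ x, HasDerivAt (fun y => (y / 2 + b y) * θ y * Ψ y ^ 2)
      ((1 / 2 + b' x) * θ x * Ψ x ^ 2 + (x / 2 + b x) * θ x * ℓ x * Ψ x ^ 2
        + 2 * (x / 2 + b x) * θ x * Ψ x * Ψ' x) x := fun x => by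
    have h1 : HasDerivAt (fun y : ℝ => y / 2) (1 / 2) x := (hasDerivAt_id' x).div_const 2
    have hlin := h1.add (hdb x)
    have hsq := (hd1 x).mul (hd1 x)
    have h := (hlin.mul (hθ' x)).mul hsq
    have hfun : (((fun y : ℝ => y / 2) + b) * θ * (Ψ * Ψ)) = fun y => (y / 2 + b y) * θ y * Ψ y ^ 2 := by
      funext y; simp only [Pi.mul_apply, Pi.add_apply]; ring
    rw [hfun] at h
    exact h.congr_deriv (by simp only [Pi.mul_apply, Pi.add_apply]; ring)
  have hF₂int : Integrable fun y => (y / 2 + b y) * θ y * Ψ y ^ 2 := by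
    have hA : Integrable fun ξ => ξ * θ ξ * Ψ ξ ^ 2 :=
      integrable_bdd_mul (φ := fun ξ => ξ * θ ξ) _ (continuous_id.mul hθc) hξθbd iΨ2
    have hB : Integrable fun ξ => b ξ * θ ξ * Ψ ξ ^ 2 := by
      refine integrable_bdd_mul (φ := fun ξ => b ξ * θ ξ) (B₀ * (1 / ε) ^ (k + 1)) (hbc'.mul hθc)
        (fun x => ?_) iΨ2
      rw [abs_mul]; exact mul_le_mul (hB₀ x) (hθbd x) (abs_nonneg _) hB₀nn
    refine ((hA.const_mul (1 / 2)).add hB).congr (Eventually.of_forall fun y => ?_)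
    simp only [Pi.add_apply]; ring
  have hF₂'int : Integrable fun x => (1 / 2 + b' x) * θ x * Ψ x ^ 2
      + (x / 2 + b x) * θ x * ℓ x * Ψ x ^ 2 + 2 * (x / 2 + b x) * θ x * Ψ x * Ψ' x := by
    refine ((((((I2.const_mul (1 / 2)).add I7).add (I8.const_mul (1 / 2))).add I9).add I4).add
      (I5.const_mul 2)).congr (Eventually.of_forall fun x => ?_)
    simp only [Pi.add_apply]; ring
  have hZ₂ := integral_eq_zero_of_hasDerivAt_of_integrable hF₂ hF₂'int hF₂int
  -- the pointwise key inequality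
  have hM₁nn : 0 ≤ M₁ := by
    have hBC : 0 ≤ B₁ / 2 + C₀ := by linarith [abs_nonneg (deriv b 0), hB₁ 0, abs_nonneg (c 0), hC₀ 0]
    rw [hM₁def]; positivity
  have hkey : ∀ ξ, ν / 2 * (θ ξ * Ψ' ξ ^ 2) + 3 * δ / 8 * (θ ξ * Ψ ξ ^ 2) ≤
      (M₁ + B₀ ^ 2 * Dsq k / (2 * δ) + ν * Dsq k / 2) * ((1 + ξ ^ 2) ^ k * Ψ ξ ^ 2)
        + 2 / δ * ((1 + ξ ^ 2) ^ (k + 1) * g ξ ^ 2)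
        + ν * (θ ξ * ℓ ξ * Ψ ξ * Ψ' ξ + θ ξ * Ψ' ξ ^ 2 + θ ξ * Ψ ξ * Ψ'' ξ)
        - 1 / 2 * ((1 / 2 + b' ξ) * θ ξ * Ψ ξ ^ 2 + (ξ / 2 + b ξ) * θ ξ * ℓ ξ * Ψ ξ ^ 2
            + 2 * (ξ / 2 + b ξ) * θ ξ * Ψ ξ * Ψ' ξ) := fun ξ => by
    have hEqξ : ν * Ψ'' ξ = (ξ / 2 + b ξ) * Ψ' ξ + (δ + (2 * (k : ℝ) + 3) / 4 + c ξ) * Ψ ξ + g ξ := by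
      have := hEq ξ; rw [hκ] at this; exact this
    exact key_pointwise (kR := (k : ℝ)) hν hδ0 (hθpos ξ) (hP0 ξ) hM₁nn
      hEqξ (id_mul_gwl_le hε0) (gw_mul_gwl_sq_le hε0 hε1) (gw_le_pow hε0) (hB₀ ξ)
      (coeff_bound hε0 hδ0.le (hB₁ ξ) (hC₀ ξ) (htail ξ))
  -- integrate it
  have iLa : Integrable fun ξ => ν / 2 * (θ ξ * Ψ' ξ ^ 2) := I1.const_mul _
  have iLb : Integrable fun ξ => 3 * δ / 8 * (θ ξ * Ψ ξ ^ 2) := I2.const_mul _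
  have iL : Integrable fun ξ => ν / 2 * (θ ξ * Ψ' ξ ^ 2) + 3 * δ / 8 * (θ ξ * Ψ ξ ^ 2) := iLa.add iLb
  have iA : Integrable fun ξ => (M₁ + B₀ ^ 2 * Dsq k / (2 * δ) + ν * Dsq k / 2)
      * ((1 + ξ ^ 2) ^ k * Ψ ξ ^ 2) := hΨk.const_mul _
  have iB : Integrable fun ξ => 2 / δ * ((1 + ξ ^ 2) ^ (k + 1) * g ξ ^ 2) := hgk.const_mul _
  have iC : Integrable fun ξ => ν * (θ ξ * ℓ ξ * Ψ ξ * Ψ' ξ + θ ξ * Ψ' ξ ^ 2 + θ ξ * Ψ ξ * Ψ'' ξ) :=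
    hF₁'int.const_mul _
  have iD : Integrable fun ξ => 1 / 2 * ((1 / 2 + b' ξ) * θ ξ * Ψ ξ ^ 2
      + (ξ / 2 + b ξ) * θ ξ * ℓ ξ * Ψ ξ ^ 2 + 2 * (ξ / 2 + b ξ) * θ ξ * Ψ ξ * Ψ' ξ) :=
    hF₂'int.const_mul _
  have iAB : Integrable fun ξ => (M₁ + B₀ ^ 2 * Dsq k / (2 * δ) + ν * Dsq k / 2)
      * ((1 + ξ ^ 2) ^ k * Ψ ξ ^ 2) + 2 / δ * ((1 + ξ ^ 2) ^ (k + 1) * g ξ ^ 2) := iA.add iB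
  have iABC : Integrable fun ξ => (M₁ + B₀ ^ 2 * Dsq k / (2 * δ) + ν * Dsq k / 2)
      * ((1 + ξ ^ 2) ^ k * Ψ ξ ^ 2) + 2 / δ * ((1 + ξ ^ 2) ^ (k + 1) * g ξ ^ 2)
      + ν * (θ ξ * ℓ ξ * Ψ ξ * Ψ' ξ + θ ξ * Ψ' ξ ^ 2 + θ ξ * Ψ ξ * Ψ'' ξ) := iAB.add iC
  have iR : Integrable fun ξ => (M₁ + B₀ ^ 2 * Dsq k / (2 * δ) + ν * Dsq k / 2)
      * ((1 + ξ ^ 2) ^ k * Ψ ξ ^ 2) + 2 / δ * ((1 + ξ ^ 2) ^ (k + 1) * g ξ ^ 2)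
      + ν * (θ ξ * ℓ ξ * Ψ ξ * Ψ' ξ + θ ξ * Ψ' ξ ^ 2 + θ ξ * Ψ ξ * Ψ'' ξ)
      - 1 / 2 * ((1 / 2 + b' ξ) * θ ξ * Ψ ξ ^ 2
        + (ξ / 2 + b ξ) * θ ξ * ℓ ξ * Ψ ξ ^ 2 + 2 * (ξ / 2 + b ξ) * θ ξ * Ψ ξ * Ψ' ξ) := iABC.sub iD
  have hmono := integral_mono iL iR hkey
  rw [integral_add iLa iLb, integral_const_mul, integral_const_mul, integral_sub iABC iD,
    integral_add iAB iC, integral_add iA iB, integral_const_mul, integral_const_mul,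
    integral_const_mul, integral_const_mul, hZ₁, hZ₂] at hmono
  have h0 : ν * (0 : ℝ) = 0 := mul_zero ν
  linarith [hmono, h0]

/-! ### §2 Removing the regularisation (Fatou) -/

/-- **Fatou step.** If `h ≥ 0` is continuous, each `gw k ε · h` (`0 < ε ≤ 1`) is integrable with `∫ gw k ε · h ≤ C`, then
`(1+ξ²)^{k+1} · h` is integrable (the weights increase to `(1+ξ²)^{k+1}` as `ε → 0⁺`). [folklore] -/
theorem integrable_weight_of_uniform_bound {k : ℕ} {h : ℝ → ℝ} {C : ℝ} (hh : Continuous h)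
    (hh0 : ∀ ξ, 0 ≤ h ξ) (hint : ∀ ε, 0 < ε → ε ≤ 1 → Integrable fun ξ => gw k ε ξ * h ξ)
    (hC : ∀ ε, 0 < ε → ε ≤ 1 → ∫ ξ, gw k ε ξ * h ξ ≤ C) :
    Integrable fun ξ => (1 + ξ ^ 2) ^ (k + 1) * h ξ := by
  have hmeas : AEStronglyMeasurable (fun ξ : ℝ => (1 + ξ ^ 2) ^ (k + 1) * h ξ) volume := by
    fun_prop
  refine ⟨hmeas, ?_⟩
  rw [hasFiniteIntegral_iff_ofReal (Eventually.of_forall fun ξ => by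
    exact mul_nonneg (by positivity) (hh0 ξ))]
  have hlim : ∀ ξ, Tendsto (fun ε => ENNReal.ofReal (gw k ε ξ * h ξ)) (𝓝[>] 0)
      (𝓝 (ENNReal.ofReal ((1 + ξ ^ 2) ^ (k + 1) * h ξ))) := fun ξ =>
    ENNReal.continuous_ofReal.continuousAt.tendsto.comp ((tendsto_gw_nhdsGT_zero ξ).mul_const (h ξ))
  have hF : (fun ξ => ENNReal.ofReal ((1 + ξ ^ 2) ^ (k + 1) * h ξ)) =
      fun ξ => liminf (fun ε => ENNReal.ofReal (gw k ε ξ * h ξ)) (𝓝[>] 0) := by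
    funext ξ; exact ((hlim ξ).liminf_eq).symm
  have hmeasε : ∀ ε : ℝ, AEMeasurable (fun ξ => ENNReal.ofReal (gw k ε ξ * h ξ)) volume := by
    intro ε
    have : Measurable fun ξ => gw k ε ξ * h ξ := by
      unfold gw
      exact ((measurable_const.add (measurable_id.pow_const 2)).pow_const _ |>.div
        ((measurable_const.add (measurable_const.mul (measurable_id.pow_const 2))).pow_const _)).mul
        hh.measurable
    exact this.ennreal_ofReal.aemeasurable
  calc ∫⁻ ξ, ENNReal.ofReal ((1 + ξ ^ 2) ^ (k + 1) * h ξ)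
      = ∫⁻ ξ, liminf (fun ε => ENNReal.ofReal (gw k ε ξ * h ξ)) (𝓝[>] 0) := by rw [hF]
    _ ≤ liminf (fun ε => ∫⁻ ξ, ENNReal.ofReal (gw k ε ξ * h ξ)) (𝓝[>] 0) := lintegral_liminf_le' hmeasε
    _ ≤ ENNReal.ofReal C := by
        refine liminf_le_of_frequently_le' (Filter.Eventually.frequently ?_)
        filter_upwards [Ioc_mem_nhdsGT (zero_lt_one' ℝ)] with ε hε
        rw [← ofReal_integral_eq_lintegral_ofReal (hint ε hε.1 hε.2)
          (Eventually.of_forall fun ξ => mul_nonneg (gw_pos hε.1.le).le (hh0 ξ))]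
        exact ENNReal.ofReal_le_ofReal (hC ε hε.1 hε.2)
    _ < ⊤ := ENNReal.ofReal_lt_top

/-- **Polynomial-weight GAIN below the drift threshold.** Let `ν > 0`, `k : ℕ`, `δ > 0`, `κ = δ + (2k+3)/4`, and let
`Ψ ∈ C²` solve `νΨ″ = (½ξ + b)Ψ′ + (κ + c)Ψ + g` at every point, with `b ∈ C¹`, `|b| ≤ B₀`, `|b′| ≤ B₁`, `c`, `g` continuous,
`|c| ≤ C₀`, and `|b′|/2 + |c| ≤ δ/4` for `|ξ| ≥ R`. If `∫(1+ξ²)^k Ψ² < ∞`, `∫(1+ξ²)^k Ψ′² < ∞` and `∫(1+ξ²)^{k+1} g² < ∞`,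
then `∫(1+ξ²)^{k+1} Ψ² < ∞` and `∫(1+ξ²)^{k+1} Ψ′² < ∞`. MODEL-support calculus; not NS. [folklore] -/
theorem weighted_gain (hν : 0 < ν) (hδ0 : 0 < δ) (hκ : κ = δ + (2 * k + 3) / 4)
    (hΨ : ContDiff ℝ 2 Ψ) (hb : ContDiff ℝ 1 b) (hc : Continuous c) (hg : Continuous g)
    (hEq : ∀ ξ, ν * deriv (deriv Ψ) ξ = (ξ / 2 + b ξ) * deriv Ψ ξ + (κ + c ξ) * Ψ ξ + g ξ)
    (hΨk : Integrable fun ξ => (1 + ξ ^ 2) ^ k * Ψ ξ ^ 2)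
    (hΨ'k : Integrable fun ξ => (1 + ξ ^ 2) ^ k * deriv Ψ ξ ^ 2)
    (hgk : Integrable fun ξ => (1 + ξ ^ 2) ^ (k + 1) * g ξ ^ 2)
    (hB₀ : ∀ ξ, |b ξ| ≤ B₀) (hB₁ : ∀ ξ, |deriv b ξ| ≤ B₁) (hC₀ : ∀ ξ, |c ξ| ≤ C₀)
    (htail : ∀ ξ, R ≤ |ξ| → |deriv b ξ| / 2 + |c ξ| ≤ δ / 4) :
    (Integrable fun ξ => (1 + ξ ^ 2) ^ (k + 1) * Ψ ξ ^ 2) ∧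
      Integrable fun ξ => (1 + ξ ^ 2) ^ (k + 1) * deriv Ψ ξ ^ 2 := by
  set K₀ : ℝ := ((B₁ / 2 + C₀) * (1 + R ^ 2) ^ (k + 1) + B₀ ^ 2 * Dsq k / (2 * δ) + ν * Dsq k / 2)
      * (∫ ξ, (1 + ξ ^ 2) ^ k * Ψ ξ ^ 2) + 2 / δ * (∫ ξ, (1 + ξ ^ 2) ^ (k + 1) * g ξ ^ 2) with hK₀
  have hbd : ∀ ε, 0 < ε → ε ≤ 1 →
      ν / 2 * (∫ ξ, gw k ε ξ * deriv Ψ ξ ^ 2) + 3 * δ / 8 * (∫ ξ, gw k ε ξ * Ψ ξ ^ 2) ≤ K₀ :=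
    fun ε hε hε1 => weighted_bound_eps hν hδ0 hκ hΨ hb hc hg hEq hΨk hΨ'k hgk hB₀ hB₁ hC₀ htail hε hε1
  have hΨc : Continuous Ψ := hΨ.continuous
  have hΨ'c : Continuous (deriv Ψ) := hΨ.continuous_deriv (by norm_num)
  have hP0 : ∀ ξ : ℝ, 1 ≤ (1 + ξ ^ 2) ^ k := fun ξ => one_le_pow₀ (by nlinarith [sq_nonneg ξ])
  have iΨ2 : Integrable fun ξ => Ψ ξ ^ 2 := by
    refine hΨk.mono' (by fun_prop) (Eventually.of_forall fun ξ => ?_)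
    rw [Real.norm_eq_abs, abs_of_nonneg (sq_nonneg _)]
    nlinarith [hP0 ξ, sq_nonneg (Ψ ξ)]
  have iΨ'2 : Integrable fun ξ => deriv Ψ ξ ^ 2 := by
    refine hΨ'k.mono' (by fun_prop) (Eventually.of_forall fun ξ => ?_)
    rw [Real.norm_eq_abs, abs_of_nonneg (sq_nonneg _)]
    nlinarith [hP0 ξ, sq_nonneg (deriv Ψ ξ)]
  have hθint : ∀ {hf : ℝ → ℝ}, Integrable hf → ∀ ε, 0 < ε → ε ≤ 1 →
      Integrable fun ξ => gw k ε ξ * hf ξ := fun hhf ε hε hε1 =>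
    hhf.bdd_mul (continuous_gw hε.le).aestronglyMeasurable (Eventually.of_forall fun ξ => by
      rw [Real.norm_eq_abs, abs_of_pos (gw_pos hε.le)]; exact gw_le_inv_pow hε hε1)
  have hnn1 : ∀ ε, 0 < ε → 0 ≤ ∫ ξ, gw k ε ξ * deriv Ψ ξ ^ 2 := fun ε hε =>
    integral_nonneg fun ξ => mul_nonneg (gw_pos hε.le).le (sq_nonneg _)
  have hnn2 : ∀ ε, 0 < ε → 0 ≤ ∫ ξ, gw k ε ξ * Ψ ξ ^ 2 := fun ε hε =>
    integral_nonneg fun ξ => mul_nonneg (gw_pos hε.le).le (sq_nonneg _)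
  constructor
  · refine integrable_weight_of_uniform_bound (C := K₀ / (3 * δ / 8)) (by fun_prop) (fun ξ => sq_nonneg _)
      (hθint iΨ2) fun ε hε hε1 => ?_
    rw [le_div_iff₀ (by positivity)]
    nlinarith [hbd ε hε hε1, hnn1 ε hε, hν]
  · refine integrable_weight_of_uniform_bound (C := K₀ / (ν / 2)) (by fun_prop) (fun ξ => sq_nonneg _)
      (hθint iΨ'2) fun ε hε hε1 => ?_
    rw [le_div_iff₀ (by positivity)]
    nlinarith [hbd ε hε hε1, hnn2 ε hε, hδ0]

end fixedEps

end SheetRWeightedGain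
end Summit.NavierStokesRegularity.OSWSelfSimilar

end
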